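import Summits.HodgeConjecture.CorCM.SexticDecicWeilFrameTransfer
import Summits.HodgeConjecture.CorCM.Census.SexticDecicWeilExtraction
import Summits.HodgeConjecture.CorCM.SexticOcticWeilFourfoldParts
import HarnessLib

/-!
# COR-CM — `E × T × B` over a sextic and a decic CM field sharing `k`: the Weil FOURFOLD parts (a curve point + the three labels of
# `T` of one sign) of the weights of every product of copies have algebraic lines, GIVEN the Weil plane of `T ⊞ E`

Cell `pub-hodgecm2` (COR-CM), seat b30 gen 27 (2026-08-23); count-neutral own lane SEXTIC-DECIC; sequel of
`CorCM/SexticDecicWeilFrameTransfer.lean`; the degree-`(6,10)` twin of gen 26ʼs `CorCM/SexticOcticWeilFourfoldParts.lean` §1–§2 (its §3,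
the Weil plane of the FOURFOLD `(T ⊞ E, ι_T(i₁δ) ⊞ ι_E(δ))` from `Markman2025_weilClasses_algebraic_abelianFourfold` —
`SexticOcticWeil.weilClassesOf_fourfold_le_algebraicClasses_of_frameS_of_markman` — does not involve the third slot and is used BY NAME
downstream).  Theorems only; no definition, no named fact, no `sorry`.  The Weil plane enters as the HYPOTHESIS `hW₂`.

* §1 `apply_eq_of_signSD` (sign ⟹ eigenvalue `±i√d` on `(δ; i₁δ, i₃δ)`), `weightClassesAlg_two_le_algebraicClasses_of_signSD` — a four-point
  weight of `Y = E ⊞ T ⊞ B` on the slots `{1, 0}` of constant sign lies in a Weil eigenline of the sub-product `T ⊞ E`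
  (`PairWeights.weightClassesAlg_le_weilClassesPlus/Minus`), algebraic by `hW₂`, pulled back (`CMWeights.weightClassesAlg_map_le_algebraicClasses`);
* §2 **`weightClassesAlg_le_algebraicClasses_of_isFourPartSD`** — ANY slot map `κ : Fin N → Fin 3`: a four part of a weight of `⨁_j A(κ j)`
  is `v`-injective, so it is the lift along `κ` (distribution lemma `CMWeights.weightClassesAlg_comp_le_algebraicClasses_of_injOn`) of such
  a weight.
HONEST FRAMING: nothing about the Hodge conjecture is concluded here; `HC_CM` is not asserted.
[cite: Deligne1982HodgeCycles, §5 (c)] [cite: vanGeemen1994HodgeAV, 4.9] [cite: Milne2020HodgeClassesAV, 1.2 (a) and Thm. 1]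
[cite: MoonenZarhin1995Duke, Thm. 2.4]

## References
* [Deligne1982HodgeCycles] P. Deligne, LNM 900 (1982), §5 (c).  [vanGeemen1994HodgeAV] B. van Geemen, LNM 1594 (1994), 3.6–3.7, 4.9.
  [Milne2020HodgeClassesAV] J. S. Milne, arXiv:2010.08857, 1.2 (a), Thm. 1.  [MoonenZarhin1995Duke] B. Moonen, Yu. Zarhin, Duke Math.
  J. 77 (1995), Thm. 2.4.
-/

noncomputable section

open CategoryTheory CategoryTheory.Limits NumberField

namespace Summit.HodgeConjecture.CorCM.SexticDecicWeil

open Literature.AlgebraicGeometry Literature.AlgebraicGeometry.Motives Literature.AlgebraicGeometry.HodgeTheory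
open Literature.AlgebraicGeometry.ComplexMultiplication (IsCMTypeRealisation)
open Literature.AlgebraicGeometry.Pohlmann1968
open Literature.AlgebraicTopology.SingularHomology
open Literature.NumberTheory.ComplexMultiplication
open Summit.HodgeConjecture.CorCM.Census.SexticDecicWeil (PtSD IsThreePartSD IsFourPartSD)
open Summit.HodgeConjecture.CorCM.SexticOcticWeil (soSlots sigma_cases₃ exists_map_sigma_eq₃ fold₄_injective)
open Summit.HodgeConjecture.CorCM.OcticCurveFourfold (comp_injective)
open Summit.HodgeConjecture.CorCM.DihedralSexticPair (card_filter_equiv_mem)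
open Summit.HodgeConjecture.CorCM.DihedralSexticPairCurve (weilClassesOf_biproduct_le_algebraicClasses_of_biprod)
open Summit.HodgeConjecture.CorCM.CMWeights (weightClassesAlg_comp_le_algebraicClasses_of_injOn
  weightClassesAlg_map_le_algebraicClasses sigma_map_injective)
open Summit.HodgeConjecture.CorCM.PairWeights

open scoped Classical

/-! ## §1 Four-point weights of `Y = E ⊞ T ⊞ B` of constant sign on the slots `{1, 0}` -/

section Four

variable {I : Type} {Kf : I → Type} [∀ i, Field (Kf i)] [∀ i, NumberField (Kf i)]
  {i₀ i₁ i₂ : I} {e₁ : (Kf i₁ →+* ℂ) ≃ Fin 3 × Bool} {e₃ : (Kf i₂ →+* ℂ) ≃ Fin 5 × Bool} {τ : Kf i₀ →+* ℂ}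
  {i₁' : Kf i₀ →+* Kf i₁} {i₃' : Kf i₀ →+* Kf i₂}
  (hk : ∀ σ : Kf i₀ →+* ℂ, σ = τ ∨ σ = ComplexEmbedding.conjugate τ)
  (he₁_sign : ∀ s : Kf i₁ →+* ℂ, (e₁ s).2 = true ↔ s.comp i₁' = τ)
  (he₃_sign : ∀ t : Kf i₂ →+* ℂ, (e₃ t).2 = true ↔ t.comp i₃' = τ)
  {A : Fin 3 → AbelianVariety ℂ} {Φ : ∀ j : Fin 3, CMType (Kf (soSlots i₀ i₁ i₂ j))}
  {ι : ∀ j, 𝓞 (Kf (soSlots i₀ i₁ i₂ j)) →+* End (A j)}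
  {θ : ∀ j, Kf (soSlots i₀ i₁ i₂ j) →+* Module.End ℂ (complexBetti (A j).X 1)}
  (hA : ∀ j, IsCMTypeRealisation (Φ j) (A j) (ι j) (θ j))
  {δ : 𝓞 (Kf i₀)} {d : ℕ} (hτ : τ (δ : Kf i₀) = Complex.I * (Real.sqrt d : ℂ))

omit [∀ i, NumberField (Kf i)] in
include hk he₁_sign he₃_sign hτ in
/-- **Sign ⟹ eigenvalue**: a point of the index set of `Y = E ⊞ T ⊞ B` of sign `b` (over `inl b`, `inr (inl (a, b))` or `inr (inr (a, b))`)
has eigenvalue `+i√d` (`b = true`) resp. `−i√d` (`b = false`) on the family `(δ; i₁δ, i₃δ)`. [cite: Deligne1982HodgeCycles, §5 (c)] -/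
theorem apply_eq_of_signSD (x : (j : Fin 3) × (Kf (soSlots i₀ i₁ i₂ j) →+* ℂ)) (b : Bool)
    (hx : toPtSD e₁ e₃ τ x = Sum.inl b ∨ (∃ a : Fin 3, toPtSD e₁ e₃ τ x = Sum.inr (Sum.inl (a, b))) ∨
      ∃ a : Fin 5, toPtSD e₁ e₃ τ x = Sum.inr (Sum.inr (a, b))) :
    x.2 (((Fin.cons δ (Fin.cons (RingOfIntegers.mapRingHom i₁' δ) fun _ : Fin 1 => RingOfIntegers.mapRingHom i₃' δ) :
        ∀ j : Fin 3, 𝓞 (Kf (soSlots i₀ i₁ i₂ j))) x.1 : 𝓞 (Kf (soSlots i₀ i₁ i₂ x.1))) : Kf (soSlots i₀ i₁ i₂ x.1)) =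
      if b then Complex.I * (Real.sqrt d : ℂ) else -(Complex.I * (Real.sqrt d : ℂ)) := by
  have hconjτ : ComplexEmbedding.conjugate τ (δ : Kf i₀) = -(Complex.I * (Real.sqrt d : ℂ)) := by
    rw [ComplexEmbedding.conjugate_coe_eq, hτ, map_mul, Complex.conj_I, Complex.conj_ofReal, neg_mul]
  rcases sigma_cases₃ x with ⟨σ, rfl⟩ | ⟨s, rfl⟩ | ⟨t, rfl⟩
  · -- the curve slot: `σ = τ_b`
    have hσ : decide (σ = τ) = b := by
      rcases hx with h | ⟨a, h⟩ | ⟨a, h⟩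
      · rw [toPtSD_zero, Sum.inl.injEq] at h; exact h
      · rw [toPtSD_zero] at h; exact absurd h Sum.inl_ne_inr
      · rw [toPtSD_zero] at h; exact absurd h Sum.inl_ne_inr
    show σ (δ : Kf i₀) = _
    cases b
    · rw [if_neg Bool.false_ne_true, (hk σ).resolve_left (of_decide_eq_false hσ)]
      exact hconjτ
    · rw [if_pos rfl, of_decide_eq_true hσ]
      exact hτ
  · -- the threefold slot: `(e₁ s).2 = b`
    have hs : (e₁ s).2 = b := by
      rcases hx with h | ⟨a, h⟩ | ⟨a, h⟩
      · rw [toPtSD_one] at h; exact absurd h Sum.inr_ne_inl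
      · rw [toPtSD_one, Sum.inr.injEq, Sum.inl.injEq, Prod.mk.injEq] at h; exact h.2
      · rw [toPtSD_one, Sum.inr.injEq] at h; exact absurd h Sum.inl_ne_inr
    show s ((RingOfIntegers.mapRingHom i₁' δ : 𝓞 (Kf i₁)) : Kf i₁) = _
    have hmap : ((RingOfIntegers.mapRingHom i₁' δ : 𝓞 (Kf i₁)) : Kf i₁) = i₁' (δ : Kf i₀) := rfl
    rw [hmap]
    change (s.comp i₁') (δ : Kf i₀) = _
    cases b
    · have h' : s.comp i₁' = ComplexEmbedding.conjugate τ := by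
        rcases hk (s.comp i₁') with h | h
        · have := (he₁_sign s).2 h; rw [hs] at this; exact absurd this Bool.false_ne_true
        · exact h
      rw [if_neg Bool.false_ne_true, h']
      exact hconjτ
    · rw [if_pos rfl, (he₁_sign s).1 hs]
      exact hτ
  · -- the fivefold slot: `(e₃ t).2 = b`
    have ht : (e₃ t).2 = b := by
      rcases hx with h | ⟨a, h⟩ | ⟨a, h⟩
      · rw [toPtSD_two] at h; exact absurd h Sum.inr_ne_inl
      · rw [toPtSD_two, Sum.inr.injEq] at h; exact absurd h Sum.inr_ne_inl
      · rw [toPtSD_two, Sum.inr.injEq, Sum.inr.injEq, Prod.mk.injEq] at h; exact h.2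
    show t ((RingOfIntegers.mapRingHom i₃' δ : 𝓞 (Kf i₂)) : Kf i₂) = _
    have hmap : ((RingOfIntegers.mapRingHom i₃' δ : 𝓞 (Kf i₂)) : Kf i₂) = i₃' (δ : Kf i₀) := rfl
    rw [hmap]
    change (t.comp i₃') (δ : Kf i₀) = _
    cases b
    · have h' : t.comp i₃' = ComplexEmbedding.conjugate τ := by
        rcases hk (t.comp i₃') with h | h
        · have := (he₃_sign t).2 h; rw [ht] at this; exact absurd this Bool.false_ne_true
        · exact h
      rw [if_neg Bool.false_ne_true, h']
      exact hconjτ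
    · rw [if_pos rfl, (he₃_sign t).1 ht]
      exact hτ

include hk he₁_sign he₃_sign hA hτ in
/-- **A four-point weight of `Y = E ⊞ T ⊞ B` of constant sign on the slots `{1, 0}` has an algebraic line, GIVEN the Weil plane of `T ⊞ E`.**
All four points have eigenvalue `±i√d` on `(δ; i₁δ, i₂δ)`, so the restriction to the sub-product `T ⊞ E` lies in a Weil eigenline
(`PairWeights.weightClassesAlg_le_weilClassesPlus/Minus`) `⊆ W ⊗ ℂ`, algebraic by `hW₂`; pull back to `Y`.
[cite: vanGeemen1994HodgeAV, 4.9] [cite: Deligne1982HodgeCycles, §5 (c)] [cite: Milne2020HodgeClassesAV, 1.2 (a)] -/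
theorem weightClassesAlg_two_le_algebraicClasses_of_signSD
    (hW₂ : weilClassesOf (A 1 ⊞ A 0) (biprod.map (ι 1 (RingOfIntegers.mapRingHom i₁' δ)) (ι 0 δ)) 2 d ≤ algebraicClasses (A 1 ⊞ A 0).X 2)
    (b : Bool) (T : Finset ((j : Fin 3) × (Kf (soSlots i₀ i₁ i₂ j) →+* ℂ))) (hTcard : T.card = 2 * 2)
    (hsgn : ∀ z ∈ T, toPtSD e₁ e₃ τ z = Sum.inl b ∨ ∃ a : Fin 3, toPtSD e₁ e₃ τ z = Sum.inr (Sum.inl (a, b))) :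
    weightClassesAlg A ι (2 * 2) T ≤ algebraicClasses (⨁ A).X 2 := by
  -- every point of `T` is on the slots `1`, `0`
  let e₄ : Fin 2 → Fin 3 := Fin.cons 1 fun _ : Fin 1 => 0
  have he₄ : Function.Injective e₄ := fold₄_injective
  have hTslot : ∀ x ∈ T, x.1 ∈ Set.range e₄ := by
    intro x hx
    rcases sigma_cases₃ x with ⟨σ, rfl⟩ | ⟨s, rfl⟩ | ⟨t, rfl⟩
    · exact ⟨1, rfl⟩
    · exact ⟨0, rfl⟩
    · rcases hsgn _ hx with h | ⟨a, h⟩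
      · rw [toPtSD_two] at h; exact absurd h Sum.inr_ne_inl
      · rw [toPtSD_two, Sum.inr.injEq] at h; exact absurd h Sum.inr_ne_inl
  obtain ⟨S'', hS''T, hS''mem⟩ := exists_map_sigma_eq₃ e₄ he₄ T hTslot
  have hcardS'' : S''.card = 2 * 2 := by rw [← hS''T, Finset.card_map] at hTcard; exact hTcard
  -- the family `(i₁δ, δ)` on the two slots, as the restriction of `(δ; i₁δ, i₂δ)`
  let aY : ∀ j : Fin 3, 𝓞 (Kf (soSlots i₀ i₁ i₂ j)) :=
    Fin.cons δ (Fin.cons (RingOfIntegers.mapRingHom i₁' δ) fun _ : Fin 1 => RingOfIntegers.mapRingHom i₃' δ)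
  let a' : ∀ j : Fin 2, 𝓞 (Kf (soSlots i₀ i₁ i₂ (e₄ j))) := fun j => aY (e₄ j)
  have hval : ∀ z ∈ S'', z.2 ((a' z.1 : 𝓞 (Kf (soSlots i₀ i₁ i₂ (e₄ z.1)))) : Kf (soSlots i₀ i₁ i₂ (e₄ z.1))) =
      if b then Complex.I * (Real.sqrt d : ℂ) else -(Complex.I * (Real.sqrt d : ℂ)) := by
    intro z hz
    have hx := hsgn _ ((hS''mem z).1 hz)
    exact apply_eq_of_signSD hk he₁_sign he₃_sign hτ ⟨e₄ z.1, z.2⟩ b (by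
      rcases hx with h | h
      · exact Or.inl h
      · exact Or.inr (Or.inl h))
  -- the Weil plane of `⨁_j A(e₄ j) = T ⊞ E`, algebraic by `hW₂`
  have hWeil : weilClassesOf (⨁ fun j => A (e₄ j)) (biproduct.map fun j => ι (e₄ j) (a' j)) 2 d ≤
      algebraicClasses (⨁ fun j => A (e₄ j)).X 2 :=
    weilClassesOf_biproduct_le_algebraicClasses_of_biprod (A := fun j => A (e₄ j)) (fun j => ι (e₄ j) (a' j)) hW₂
  have halg : weightClassesAlg (K := fun j => Kf (soSlots i₀ i₁ i₂ (e₄ j))) (fun j => A (e₄ j)) (fun j => ι (e₄ j)) (2 * 2) S'' ≤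
      algebraicClasses (⨁ fun j => A (e₄ j)).X 2 := by
    cases b
    · refine (weightClassesAlg_le_weilClassesMinus (K := fun j => Kf (soSlots i₀ i₁ i₂ (e₄ j))) (A := fun j => A (e₄ j))
        (ι := fun j => ι (e₄ j)) a' hcardS'' fun z hz => ?_).trans ((weilClassesMinus_le_weilClassesOf _ _ 2 d).trans hWeil)
      simpa using hval z hz
    · refine (weightClassesAlg_le_weilClassesPlus (K := fun j => Kf (soSlots i₀ i₁ i₂ (e₄ j))) (A := fun j => A (e₄ j))
        (ι := fun j => ι (e₄ j)) a' hcardS'' fun z hz => ?_).trans ((weilClassesPlus_le_weilClassesOf _ _ 2 d).trans hWeil)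
      simpa using hval z hz
  rw [← hS''T]
  exact weightClassesAlg_map_le_algebraicClasses hA e₄ he₄ hcardS'' halg

end Four

/-! ## §2 The four parts of the products of copies -/

section FourX

variable {I : Type} {Kf : I → Type} [∀ i, Field (Kf i)] [∀ i, NumberField (Kf i)]
  {i₀ i₁ i₂ : I} {N : ℕ} (κ : Fin N → Fin 3) {e₁ : (Kf i₁ →+* ℂ) ≃ Fin 3 × Bool} {e₃ : (Kf i₂ →+* ℂ) ≃ Fin 5 × Bool}
  {τ : Kf i₀ →+* ℂ} {i₁' : Kf i₀ →+* Kf i₁} {i₃' : Kf i₀ →+* Kf i₂}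
  (hk : ∀ σ : Kf i₀ →+* ℂ, σ = τ ∨ σ = ComplexEmbedding.conjugate τ)
  (he₁_sign : ∀ s : Kf i₁ →+* ℂ, (e₁ s).2 = true ↔ s.comp i₁' = τ)
  (he₃_sign : ∀ t : Kf i₂ →+* ℂ, (e₃ t).2 = true ↔ t.comp i₃' = τ)
  {A : Fin 3 → AbelianVariety ℂ} {Φ : ∀ j : Fin 3, CMType (Kf (soSlots i₀ i₁ i₂ j))}
  {ι : ∀ j, 𝓞 (Kf (soSlots i₀ i₁ i₂ j)) →+* End (A j)}
  {θ : ∀ j, Kf (soSlots i₀ i₁ i₂ j) →+* Module.End ℂ (complexBetti (A j).X 1)}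
  (hA : ∀ j, IsCMTypeRealisation (Φ j) (A j) (ι j) (θ j))
  {δ : 𝓞 (Kf i₀)} {d : ℕ} (hτ : τ (δ : Kf i₀) = Complex.I * (Real.sqrt d : ℂ))

omit [∀ i, NumberField (Kf i)] in
/-- The model map is injective on a four part (one point over each of its four labels). [folklore] -/
theorem _root_.Summit.HodgeConjecture.CorCM.Census.SexticDecicWeil.IsFourPartSD.injOn {α : Type*} {v : α → PtSD} {b : Bool}
    {G : Finset α} (hG : IsFourPartSD v b G) : Set.InjOn v ↑G := by
  obtain ⟨x, G₁, hxG₁, rfl, hvx, hG₁⟩ := hG.exists_split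
  intro z hz z' hz' h
  simp only [Finset.coe_insert, Set.mem_insert_iff, Finset.mem_coe] at hz hz'
  rcases hz with rfl | hz <;> rcases hz' with rfl | hz'
  · rfl
  · obtain ⟨a, ha⟩ := hG₁.exists_eq hz'
    rw [hvx, ha] at h; exact absurd h Sum.inl_ne_inr
  · obtain ⟨a, ha⟩ := hG₁.exists_eq hz
    rw [hvx, ha] at h; exact absurd h Sum.inr_ne_inl
  · exact hG₁.injOn hz hz' h

include hk he₁_sign he₃_sign hA hτ in
/-- **THE FOUR PARTS HAVE ALGEBRAIC LINES (any slot map).**  For `κ : Fin N → Fin 3` and a four part `G` (sign `b`) of a weight of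
`X = ⨁_j A(κ j)` — a curve point over `τ_b` and the three labels `(1, a, b)` — `H⁴(X)_G ⊆ N² H⁴(X)`, GIVEN the Weil plane of `T ⊞ E`:
the part is `v`-injective, its slot projection is a four-point weight of `Y` of constant sign on the slots `{1, 0}` (§1), lifted along `κ`
(distribution lemma). [cite: Milne2020HodgeClassesAV, 1.2 (a) and Thm. 1] [cite: Deligne1982HodgeCycles, §5 (c)] -/
theorem weightClassesAlg_le_algebraicClasses_of_isFourPartSD
    (hW₂ : weilClassesOf (A 1 ⊞ A 0) (biprod.map (ι 1 (RingOfIntegers.mapRingHom i₁' δ)) (ι 0 δ)) 2 d ≤ algebraicClasses (A 1 ⊞ A 0).X 2)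
    {b : Bool} {G : Finset ((j : Fin N) × (Kf (soSlots i₀ i₁ i₂ (κ j)) →+* ℂ))}
    (hG : IsFourPartSD (fun x => toPtSD e₁ e₃ τ ((Sigma.map κ (fun _ => id) :
      ((j : Fin N) × (Kf (soSlots i₀ i₁ i₂ (κ j)) →+* ℂ)) → ((m : Fin 3) × (Kf (soSlots i₀ i₁ i₂ m) →+* ℂ))) x)) b G) :
    G.card = 2 * 2 ∧ weightClassesAlg (fun j => A (κ j)) (fun j => ι (κ j)) (2 * 2) G ≤
      algebraicClasses (⨁ fun j => A (κ j)).X 2 := by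
  have hGcard : G.card = 2 * 2 := by rw [hG.1]
  refine ⟨hGcard, ?_⟩
  set Pm : ((j : Fin N) × (Kf (soSlots i₀ i₁ i₂ (κ j)) →+* ℂ)) → ((m : Fin 3) × (Kf (soSlots i₀ i₁ i₂ m) →+* ℂ)) :=
    Sigma.map κ (fun _ => id) with hPm
  have hinj := hG.injOn
  have hPinj : Set.InjOn Pm ↑G := fun x hx x' hx' h => hinj hx hx' (by
    change toPtSD e₁ e₃ τ (Pm x) = toPtSD e₁ e₃ τ (Pm x'); rw [h])
  set TY : Finset ((m : Fin 3) × (Kf (soSlots i₀ i₁ i₂ m) →+* ℂ)) := G.image Pm with hTY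
  have hTYcard : TY.card = 2 * 2 := by rw [hTY, Finset.card_image_of_injOn hPinj, hGcard]
  have hsgn : ∀ z ∈ TY, toPtSD e₁ e₃ τ z = Sum.inl b ∨ ∃ a : Fin 3, toPtSD e₁ e₃ τ z = Sum.inr (Sum.inl (a, b)) := by
    intro z hz
    obtain ⟨x, hx, rfl⟩ := Finset.mem_image.1 hz
    exact hG.mem_cases hx
  have hYalg := weightClassesAlg_two_le_algebraicClasses_of_signSD hk he₁_sign he₃_sign hA hτ hW₂ b TY hTYcard hsgn
  exact weightClassesAlg_comp_le_algebraicClasses_of_injOn (K := fun m => Kf (soSlots i₀ i₁ i₂ m)) hA κ hGcard hPinj hYalg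

end FourX

end Summit.HodgeConjecture.CorCM.SexticDecicWeil

end
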